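import Literature.NumberTheory.GaloisRepresentations.ChebotarevArtinRep
import Mathlib.NumberTheory.Padics.PadicIntegers
import Mathlib.Topology.Algebra.Ring.Ideal
import Mathlib.Analysis.Normed.Group.Ultra
import HarnessLib

/-!
# [telescope — width x2-p2 g24, 2026-08-30] FROBENIUS CHARACTERISTIC POLYNOMIALS DETERMINE ALL CHARACTERISTIC POLYNOMIALS for continuous
# `p`-adic Galois representations `ρ₁, ρ₂ : Γ_F →ₜ* GL_n(ℤ_p)`: if `ρ₁` and `ρ₂` have the same Frobenius characteristic polynomial at every
# finite place outside a finite set `S`, then `charpoly (ρ₁ g) = charpoly (ρ₂ g)` for EVERY `g ∈ Γ_F` (Chebotarev density, in the tree's proved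
# open-kernel form, applied to the reductions `(ρ₁ ⊕ ρ₂) mod pᵐ`) — the «Chebotarev» half of rider TU-ident / step (D7) of T-An-2ᵍ/T-An-2ᴴ
# Crux 4 `BSDpOnCellC` (stmt-BirchSwinnertonDyer-19034), line «telescope» (`--supports`, helper; closes nothing)

WHY: the last classical rider of the re-sourced load-bearing fact T-An-2ᴴ (`…exists_untwistedGaloisLattice_on_pNewBranchChart`) is TU-ident:
Hida's (2.2c) compares the reduction `π mod P_t` with «`π(f_{P_t})`, the representation CHARACTERISED BY (2.1a,b)» (unramified outside `Np`,
Frobenius characteristic polynomials `X² − a_ℓ X + ℓ^{k−1}`), while the typed clause compares it with the tree's `(D t).Δ.ρ`, which carries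
(2.1a,b) as `OrdinaryNewformDatum.charpoly`. The identification is «Chebotarev + Brauer–Nesbitt + irreducibility»; Brauer–Nesbitt is PROVED in the
tree (`GaloisRepresentations.brauerNesbitt_holds`, `PatchingLemma.exists_conj_of_trace_eq`), and THIS FILE proves the Chebotarev half for
`p`-adic INTEGRAL coefficients: `charpoly_eq_of_hasFrobCharpolyAt` — equal Frobenius data off a finite `S` ⟹ equal characteristic
polynomials on all of `Γ_F`. Proof: for each `m`, the reduction of `ρ₁ ⊕ ρ₂` modulo the open ideal `pᵐℤ_p` is a framed representation over
`ℤ_p ⧸ pᵐ` with OPEN kernel `U_m`, so the tree's Chebotarev theorem in open-kernel form (`FramedGaloisRep.infinite_setOf_frobenius_mem_mul_ker_of_cyclic`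
over `infinite_setOf_frobenius_eq_of_isCyclic chebotarev_cyclotomicExtension_holds`) yields, for every `g`, a place `v ∉ S` and an arithmetic
Frobenius `Φ` with `g⁻¹Φ ∈ U_m`; hence `charpoly (ρᵢ g) ≡ charpoly (ρᵢ Φ) = P_v (mod pᵐ)` for `i = 1, 2`, and `m → ∞`.

CONTENT (namespace `…Theorems.TelescopeBranchFrobeniusCharpolyTransfer`; THEOREMS ONLY): §1 `exists_blockDiag` (the framed `ρ₁ ⊕ ρ₂`),
`exists_reduction` (reduction modulo an open ideal has open kernel); §2 `exists_frob_of_isOpen` (a Frobenius in every coset of an open kernel, off any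
finite `S`); §3 **`charpoly_eq_of_hasFrobCharpolyAt_of_separating`** (any topological ring whose open ideals separate points), `isOpen_span_pow`,
`eq_zero_of_forall_mem_span_pow`, **`charpoly_eq_of_hasFrobCharpolyAt`** (`ℤ_p`).

HONEST FRAMING: a general theorem on `p`-adic Galois representations; identifies no specific representation; closes no registered stub, no crux, no
summit statement; BSD is proved for no curve by this file. No named fact, no definition, no instance, no `sorry`.
References (shape only): [cite: SerreAbelianLadic1968, Ch. I §2.3 (Čebotarev's theorem and its corollary)] [cite: Hida1986, §2 (2.1a) (2.1b) (2.2c)]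
-/

set_option autoImplicit false
set_option linter.dupNamespace false

noncomputable section

open scoped Classical MatrixGroups
open IsDedekindDomain NumberField Field
open Literature.NumberTheory.GaloisRepresentations

namespace Summit.BirchSwinnertonDyer.BirchSwinnertonDyer.Theorems.TelescopeBranchFrobeniusCharpolyTransfer

universe u v

/-! ### §1. Pairing and reduction of framed representations -/

section Pairing

variable {G : Type u} [Group G] [TopologicalSpace G] {A : Type v} [CommRing A] [TopologicalSpace A] [IsTopologicalRing A] {n n' : ℕ}

omit [IsTopologicalRing A] in
/-- **The framed direct sum `ρ₁ ⊕ ρ₂`** (block-diagonal matrices, reindexed to `Fin (n + n')`): a framed continuous representation whose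
matrix at `g` is `reindex (fromBlocks (ρ₁ g) 0 0 (ρ₂ g))`. [folklore] -/
theorem exists_blockDiag (ρ₁ : FramedRep G A n) (ρ₂ : FramedRep G A n') :
    ∃ ρ : FramedRep G A (n + n'), ∀ g : G,
      ((ρ g : GL (Fin (n + n')) A) : Matrix (Fin (n + n')) (Fin (n + n')) A) =
        Matrix.reindex finSumFinEquiv finSumFinEquiv
          (Matrix.fromBlocks ((ρ₁ g : GL (Fin n) A) : Matrix (Fin n) (Fin n) A) 0 0
            ((ρ₂ g : GL (Fin n') A) : Matrix (Fin n') (Fin n') A)) := by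
  -- the block-diagonal unit
  let B : G → Matrix (Fin n ⊕ Fin n') (Fin n ⊕ Fin n') A := fun g =>
    Matrix.fromBlocks ((ρ₁ g : GL (Fin n) A) : Matrix (Fin n) (Fin n) A) 0 0 ((ρ₂ g : GL (Fin n') A) : Matrix (Fin n') (Fin n') A)
  let B' : G → Matrix (Fin n ⊕ Fin n') (Fin n ⊕ Fin n') A := fun g =>
    Matrix.fromBlocks (((ρ₁ g)⁻¹ : GL (Fin n) A) : Matrix (Fin n) (Fin n) A) 0 0 (((ρ₂ g)⁻¹ : GL (Fin n') A) : Matrix (Fin n') (Fin n') A)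
  have hBmul : ∀ g h, B (g * h) = B g * B h := by
    intro g h
    simp only [B, map_mul, Units.val_mul, Matrix.fromBlocks_multiply, Matrix.mul_zero, Matrix.zero_mul, add_zero, zero_add]
  have hBone : B 1 = 1 := by
    simp only [B, map_one, Units.val_one, Matrix.fromBlocks_one]
  have hBB' : ∀ g, B g * B' g = 1 := by
    intro g
    simp only [B, B', Matrix.fromBlocks_multiply, Matrix.mul_zero, Matrix.zero_mul, add_zero, zero_add, Units.mul_inv,
      Matrix.fromBlocks_one]
  have hB'B : ∀ g, B' g * B g = 1 := by
    intro g
    simp only [B, B', Matrix.fromBlocks_multiply, Matrix.mul_zero, Matrix.zero_mul, add_zero, zero_add, Units.inv_mul,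
      Matrix.fromBlocks_one]
  let e := (finSumFinEquiv : Fin n ⊕ Fin n' ≃ Fin (n + n'))
  let R : Matrix (Fin n ⊕ Fin n') (Fin n ⊕ Fin n') A →ₐ[A] Matrix (Fin (n + n')) (Fin (n + n')) A :=
    (Matrix.reindexAlgEquiv A A e).toAlgHom
  let U : G → GL (Fin (n + n')) A := fun g =>
    ⟨R (B g), R (B' g), by rw [← map_mul, hBB', map_one], by rw [← map_mul, hB'B, map_one]⟩
  have hUmul : ∀ g h, U (g * h) = U g * U h := fun g h => Units.ext (by
    change R (B (g * h)) = R (B g) * R (B h)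
    rw [hBmul, map_mul])
  have hUone : U 1 = 1 := Units.ext (by change R (B 1) = 1; rw [hBone, map_one])
  -- continuity
  have hR : Continuous (R : Matrix (Fin n ⊕ Fin n') (Fin n ⊕ Fin n') A → Matrix (Fin (n + n')) (Fin (n + n')) A) := by
    change Continuous fun M : Matrix (Fin n ⊕ Fin n') (Fin n ⊕ Fin n') A => Matrix.reindex e e M
    exact Continuous.matrix_submatrix continuous_id _ _
  have hB : Continuous B :=
    Continuous.matrix_fromBlocks (Units.continuous_val.comp (map_continuous ρ₁)) continuous_const continuous_const
      (Units.continuous_val.comp (map_continuous ρ₂))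
  have hB' : Continuous B' :=
    Continuous.matrix_fromBlocks (Units.continuous_coe_inv.comp (map_continuous ρ₁)) continuous_const continuous_const
      (Units.continuous_coe_inv.comp (map_continuous ρ₂))
  refine ⟨{ toFun := U, map_one' := hUone, map_mul' := hUmul,
            continuous_toFun := Units.continuous_iff.2 ⟨hR.comp hB, hR.comp hB'⟩ }, fun g => rfl⟩

/-- **Reduction modulo an open ideal has open kernel**: for `I ⊆ A` open, `ρ mod I : G →ₜ* GL_k(A ⧸ I)` exists with
`(ρ mod I)(g) = (ρ g).map mk` and `ker (ρ mod I) = {g | ρ g ≡ 1 (mod I)}` OPEN. [folklore] -/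
theorem exists_reduction {k : ℕ} (ρ : FramedRep G A k) (I : Ideal A) (hI : IsOpen (I : Set A)) :
    ∃ ρI : FramedRep G (A ⧸ I) k,
      (∀ g : G, ((ρI g : GL (Fin k) (A ⧸ I)) : Matrix (Fin k) (Fin k) (A ⧸ I)) =
        ((ρ g : GL (Fin k) A) : Matrix (Fin k) (Fin k) A).map (Ideal.Quotient.mk I)) ∧
      IsOpen (ρI.toMonoidHom.ker : Set G) ∧
      (∀ g ∈ ρI.toMonoidHom.ker, ∀ i j,
        ((ρ g : GL (Fin k) A) : Matrix (Fin k) (Fin k) A) i j - (1 : Matrix (Fin k) (Fin k) A) i j ∈ I) := by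
  have hmk : Continuous (Ideal.Quotient.mk I : A → A ⧸ I) := continuous_quot_mk
  let f : GL (Fin k) A →* GL (Fin k) (A ⧸ I) := Units.map (RingHom.mapMatrix (Ideal.Quotient.mk I)).toMonoidHom
  have hf : Continuous f := Continuous.units_map _ (Continuous.matrix_map continuous_id hmk)
  let ρI : FramedRep G (A ⧸ I) k := { toMonoidHom := f.comp ρ.toMonoidHom, continuous_toFun := hf.comp (map_continuous ρ) }
  have hρI : ∀ g, ((ρI g : GL (Fin k) (A ⧸ I)) : Matrix (Fin k) (Fin k) (A ⧸ I)) =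
      ((ρ g : GL (Fin k) A) : Matrix (Fin k) (Fin k) A).map (Ideal.Quotient.mk I) := fun g => rfl
  have hker : ∀ g, g ∈ ρI.toMonoidHom.ker ↔
      ∀ i j, ((ρ g : GL (Fin k) A) : Matrix (Fin k) (Fin k) A) i j - (1 : Matrix (Fin k) (Fin k) A) i j ∈ I := by
    intro g
    rw [MonoidHom.mem_ker, Units.ext_iff, ← Matrix.ext_iff]
    refine forall_congr' fun i => forall_congr' fun j => ?_
    change (((ρ g : GL (Fin k) A) : Matrix (Fin k) (Fin k) A).map (Ideal.Quotient.mk I)) i j = (1 : Matrix (Fin k) (Fin k) (A ⧸ I)) i j ↔ _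
    have h1 : (1 : Matrix (Fin k) (Fin k) (A ⧸ I)) i j = Ideal.Quotient.mk I ((1 : Matrix (Fin k) (Fin k) A) i j) := by
      rw [← Matrix.map_one (Ideal.Quotient.mk I) (map_zero _) (map_one _)]; rfl
    rw [Matrix.map_apply, h1, Ideal.Quotient.eq]
  refine ⟨ρI, hρI, ?_, fun g hg => (hker g).1 hg⟩
  have hset : (ρI.toMonoidHom.ker : Set G) =
      ⋂ i : Fin k, ⋂ j : Fin k, (fun g => ((ρ g : GL (Fin k) A) : Matrix (Fin k) (Fin k) A) i j - (1 : Matrix (Fin k) (Fin k) A) i j) ⁻¹' (I : Set A) := by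
    ext g
    simp only [SetLike.mem_coe, Set.mem_iInter, Set.mem_preimage]
    exact hker g
  rw [hset]
  refine isOpen_iInter_of_finite fun i => isOpen_iInter_of_finite fun j => hI.preimage ?_
  exact ((Continuous.matrix_elem (Units.continuous_val.comp (map_continuous ρ)) i j).sub continuous_const)

end Pairing

/-! ### §2. A Frobenius in every coset of an open kernel, off any finite set of places -/

/-- The cyclic case of Chebotarev's theorem in the existence form the tree's open-kernel theorem consumes (the tree's
`infinite_setOf_frobenius_eq_of_isCyclic` over the proved `chebotarev_cyclotomicExtension_holds`). [cite: TateGCFT1967, §2.4] -/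
theorem chebotarev_cyclic_case :
    ∀ (M L : Type) [Field M] [NumberField M] [Field L] [NumberField L] [Algebra M L]
      [IsGalois M L] (g : L ≃ₐ[M] L), (∀ x : L ≃ₐ[M] L, x ∈ Subgroup.zpowers g) →
      {q : HeightOneSpectrum (𝓞 M) | (Ideal.absNorm q.asIdeal).Prime ∧
        Algebra.IsUnramifiedIn (𝓞 L) q.asIdeal ∧
        ∀ Q ∈ q.asIdeal.primesOver (𝓞 L), ∀ φ : L ≃ₐ[M] L,
          IsArithFrobAt (𝓞 M) φ Q → φ = g}.Infinite :=
  fun _ _ _ _ _ _ _ _ g hg => infinite_setOf_frobenius_eq_of_isCyclic chebotarev_cyclotomicExtension_holds g hg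

/-- **A Frobenius in every coset of an open kernel, away from `S`**: for `σ : Γ_F →ₜ* GL_k(A)` with open kernel, a finite set `S` of places and
`g ∈ Γ_F`, there are a place `v ∉ S` and an arithmetic Frobenius `Φ` above `v` with `g⁻¹Φ ∈ ker σ`. [cite: TateGCFT1967, §2.4 (Tchebotarev density theorem)] -/
theorem exists_frob_of_isOpen {F : Type} [Field F] [NumberField F] {A : Type v} [CommRing A] [TopologicalSpace A] {k : ℕ}
    (σ : FramedGaloisRep F A k) (hker : IsOpen (σ.toMonoidHom.ker : Set (absoluteGaloisGroup F)))
    (S : Set (HeightOneSpectrum (𝓞 F))) (hS : S.Finite) (g : absoluteGaloisGroup F) :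
    ∃ v : HeightOneSpectrum (𝓞 F), v ∉ S ∧ ∃ 𝔓 ∈ v.primesAbove,
      ∃ Φ : absoluteGaloisGroup F, IsArithFrobAt (𝓞 F) Φ 𝔓 ∧ g⁻¹ * Φ ∈ σ.toMonoidHom.ker := by
  have hinf := FramedGaloisRep.infinite_setOf_frobenius_mem_mul_ker_of_cyclic chebotarev_cyclic_case σ hker g
  obtain ⟨v, ⟨-, 𝔓, h𝔓, Φ, hΦ, hmem⟩, hvS⟩ := (hinf.sdiff hS).nonempty
  exact ⟨v, hvS, 𝔓, h𝔓, Φ, hΦ, hmem⟩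

/-! ### §3. Frobenius characteristic polynomials determine all characteristic polynomials (`ℤ_p`-coefficients) -/

variable {p : ℕ} [Fact p.Prime]

/-- `pᵐ ℤ_p` is open. [folklore] -/
theorem isOpen_span_pow (m : ℕ) : IsOpen ((Ideal.span {(p : ℤ_[p]) ^ m} : Ideal ℤ_[p]) : Set ℤ_[p]) := by
  have h : ((Ideal.span {(p : ℤ_[p]) ^ m} : Ideal ℤ_[p]) : Set ℤ_[p]) = Metric.closedBall (0 : ℤ_[p]) ((p : ℝ) ^ (-(m : ℤ))) := by
    ext x
    rw [SetLike.mem_coe, ← PadicInt.norm_le_pow_iff_mem_span_pow, Metric.mem_closedBall, dist_zero_right]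
  rw [h]
  exact IsUltrametricDist.isOpen_closedBall 0 (zpow_ne_zero _ (by exact_mod_cast (Fact.out : p.Prime).ne_zero))

/-- An element of `ℤ_p` lying in `pᵐ ℤ_p` for every `m` is `0`. [folklore] -/
theorem eq_zero_of_forall_mem_span_pow {x : ℤ_[p]} (h : ∀ m : ℕ, x ∈ (Ideal.span {(p : ℤ_[p]) ^ m} : Ideal ℤ_[p])) : x = 0 := by
  have hp1 : (1 : ℝ) < p := by exact_mod_cast (Fact.out : p.Prime).one_lt
  have h0 : ‖x‖ ≤ 0 := by
    refine ge_of_tendsto (tendsto_pow_atTop_nhds_zero_of_lt_one (by positivity) (inv_lt_one_of_one_lt₀ hp1)) ?_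
    refine Filter.Eventually.of_forall fun m => ?_
    have h1 := (PadicInt.norm_le_pow_iff_mem_span_pow x m).mpr (h m)
    rwa [zpow_neg, zpow_natCast, ← inv_pow] at h1
  exact norm_le_zero_iff.mp h0

set_option maxHeartbeats 1600000 in
/-- **Frobenius characteristic polynomials determine all characteristic polynomials (general coefficients).** Let `F` be a number field, `A`
a topological commutative ring WHOSE OPEN IDEALS SEPARATE POINTS (`hsep`; e.g. `ℤ_p`, the integers of a `p`-adic field, any ring with a basis
of open ideals at `0` and Hausdorff), `ρ₁ ρ₂ : Γ_F →ₜ* GL_n(A)` continuous, `S` a finite set of finite places such that at every `v ∉ S` both have the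
SAME Frobenius characteristic polynomial. Then `charpoly (ρ₁ g) = charpoly (ρ₂ g)` for every `g ∈ Γ_F` (for each open ideal `I`, the reduction of
`ρ₁ ⊕ ρ₂` mod `I` has open kernel, and Chebotarev supplies a Frobenius in `g · ker` off `S`).
[cite: SerreAbelianLadic1968, Ch. I §2.3 (Čebotarev density and its Corollary)] -/
theorem charpoly_eq_of_hasFrobCharpolyAt_of_separating {F : Type} [Field F] [NumberField F]
    {A : Type v} [CommRing A] [TopologicalSpace A] [IsTopologicalRing A]
    (hsep : ∀ x : A, (∀ I : Ideal A, IsOpen (I : Set A) → x ∈ I) → x = 0)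
    {n : ℕ} (ρ₁ ρ₂ : FramedGaloisRep F A n)
    (S : Set (HeightOneSpectrum (𝓞 F))) (hS : S.Finite)
    (h : ∀ v : HeightOneSpectrum (𝓞 F), v ∉ S → ∃ P : Polynomial A, ρ₁.HasFrobCharpolyAt v P ∧ ρ₂.HasFrobCharpolyAt v P)
    (g : absoluteGaloisGroup F) : FramedRep.charpoly ρ₁ g = FramedRep.charpoly ρ₂ g := by
  -- it suffices to prove the congruence modulo every open ideal `I`
  rw [← sub_eq_zero]
  refine Polynomial.ext fun d => ?_
  rw [Polynomial.coeff_sub, Polynomial.coeff_zero]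
  refine hsep _ fun I hI => ?_
  -- the reduction of `ρ₁ ⊕ ρ₂` modulo `I`
  obtain ⟨ρ, hρ⟩ := exists_blockDiag ρ₁ ρ₂
  obtain ⟨ρI, hρI, hker, hcong⟩ := exists_reduction ρ I hI
  -- a Frobenius `Φ` above some `v ∉ S` in the coset `g · ker`
  obtain ⟨v, hvS, 𝔓, h𝔓, Φ, hΦ, hmem⟩ := exists_frob_of_isOpen ρI hker S hS g
  obtain ⟨P, hP₁, hP₂⟩ := h v hvS
  have e₁ : FramedRep.charpoly ρ₁ Φ = P := hP₁ 𝔓 h𝔓 Φ hΦ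
  have e₂ : FramedRep.charpoly ρ₂ Φ = P := hP₂ 𝔓 h𝔓 Φ hΦ
  -- `ρᵢ (g⁻¹ Φ) ≡ 1 (mod I)` entrywise, from the block structure
  have hc := hcong (g⁻¹ * Φ) hmem
  have hblock : ∀ (i j : Fin n),
      ((ρ₁ (g⁻¹ * Φ) : GL (Fin n) A) : Matrix (Fin n) (Fin n) A) i j - (1 : Matrix (Fin n) (Fin n) A) i j ∈ I ∧
      ((ρ₂ (g⁻¹ * Φ) : GL (Fin n) A) : Matrix (Fin n) (Fin n) A) i j - (1 : Matrix (Fin n) (Fin n) A) i j ∈ I := by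
    intro i j
    constructor
    · have h1 := hc (finSumFinEquiv (Sum.inl i)) (finSumFinEquiv (Sum.inl j))
      rw [hρ, Matrix.reindex_apply, Matrix.submatrix_apply, Equiv.symm_apply_apply, Equiv.symm_apply_apply, Matrix.fromBlocks_apply₁₁,
        Matrix.one_apply] at h1
      simp only [EmbeddingLike.apply_eq_iff_eq, Sum.inl.injEq] at h1
      rwa [Matrix.one_apply]
    · have h1 := hc (finSumFinEquiv (Sum.inr i)) (finSumFinEquiv (Sum.inr j))
      rw [hρ, Matrix.reindex_apply, Matrix.submatrix_apply, Equiv.symm_apply_apply, Equiv.symm_apply_apply, Matrix.fromBlocks_apply₂₂,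
        Matrix.one_apply] at h1
      simp only [EmbeddingLike.apply_eq_iff_eq, Sum.inr.injEq] at h1
      rwa [Matrix.one_apply]
  -- hence `ρᵢ Φ ≡ ρᵢ g (mod I)` as matrices over `A ⧸ I`
  have hred : ∀ (τ : FramedGaloisRep F A n),
      (∀ i j, ((τ (g⁻¹ * Φ) : GL (Fin n) A) : Matrix (Fin n) (Fin n) A) i j - (1 : Matrix (Fin n) (Fin n) A) i j ∈ I) →
      ((τ Φ : GL (Fin n) A) : Matrix (Fin n) (Fin n) A).map (Ideal.Quotient.mk I) =
        ((τ g : GL (Fin n) A) : Matrix (Fin n) (Fin n) A).map (Ideal.Quotient.mk I) := by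
    intro τ hτ
    have hone : ((τ (g⁻¹ * Φ) : GL (Fin n) A) : Matrix (Fin n) (Fin n) A).map (Ideal.Quotient.mk I) = 1 := by
      ext i j
      rw [Matrix.map_apply, ← Matrix.map_one (Ideal.Quotient.mk I) (map_zero _) (map_one _), Matrix.map_apply, Ideal.Quotient.eq]
      exact hτ i j
    have hΦ' : Φ = g * (g⁻¹ * Φ) := by group
    conv_lhs => rw [hΦ', map_mul, Units.val_mul, Matrix.map_mul, hone, mul_one]
  -- characteristic polynomials commute with reduction
  have hchar : ∀ (τ : FramedGaloisRep F A n),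
      (∀ i j, ((τ (g⁻¹ * Φ) : GL (Fin n) A) : Matrix (Fin n) (Fin n) A) i j - (1 : Matrix (Fin n) (Fin n) A) i j ∈ I) →
      (FramedRep.charpoly τ Φ).map (Ideal.Quotient.mk I) = (FramedRep.charpoly τ g).map (Ideal.Quotient.mk I) := by
    intro τ hτ
    change (((τ Φ : GL (Fin n) A) : Matrix (Fin n) (Fin n) A).charpoly).map _ =
      (((τ g : GL (Fin n) A) : Matrix (Fin n) (Fin n) A).charpoly).map _
    rw [← Matrix.charpoly_map, ← Matrix.charpoly_map, hred τ hτ]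
  have h₁ := hchar ρ₁ (fun i j => (hblock i j).1)
  have h₂ := hchar ρ₂ (fun i j => (hblock i j).2)
  rw [e₁] at h₁
  rw [e₂] at h₂
  have hdiff : ((FramedRep.charpoly ρ₁ g - FramedRep.charpoly ρ₂ g).map (Ideal.Quotient.mk I)).coeff d = 0 := by
    rw [Polynomial.map_sub, ← h₁, ← h₂, sub_self, Polynomial.coeff_zero]
  rw [Polynomial.coeff_map, Polynomial.coeff_sub] at hdiff
  exact Ideal.Quotient.eq_zero_iff_mem.mp hdiff

/-- **Frobenius characteristic polynomials determine all characteristic polynomials (`ℤ_p`-coefficients).** For continuous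
`ρ₁ ρ₂ : Γ_F →ₜ* GL_n(ℤ_p)` with the same Frobenius characteristic polynomial at every place outside a finite `S`:
`charpoly (ρ₁ g) = charpoly (ρ₂ g)` for every `g ∈ Γ_F` (the open ideals `pᵐℤ_p` separate points).
[cite: SerreAbelianLadic1968, Ch. I §2.3 (Čebotarev density and its Corollary)] -/
theorem charpoly_eq_of_hasFrobCharpolyAt {F : Type} [Field F] [NumberField F] {n : ℕ} (ρ₁ ρ₂ : FramedGaloisRep F ℤ_[p] n)
    (S : Set (HeightOneSpectrum (𝓞 F))) (hS : S.Finite)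
    (h : ∀ v : HeightOneSpectrum (𝓞 F), v ∉ S → ∃ P : Polynomial ℤ_[p], ρ₁.HasFrobCharpolyAt v P ∧ ρ₂.HasFrobCharpolyAt v P)
    (g : absoluteGaloisGroup F) : FramedRep.charpoly ρ₁ g = FramedRep.charpoly ρ₂ g :=
  charpoly_eq_of_hasFrobCharpolyAt_of_separating
    (fun _ hx => eq_zero_of_forall_mem_span_pow fun m => hx _ (isOpen_span_pow m)) ρ₁ ρ₂ S hS h g

end Summit.BirchSwinnertonDyer.BirchSwinnertonDyer.Theorems.TelescopeBranchFrobeniusCharpolyTransfer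

end
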